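import Summits.QuantumAdvantage.QuantumAdvantage.Theorems.CubicForrelationNearExactIsExactTwelveLevelSixH34Avoid

/-!
# Crux `CubicForrelation.NearExactIsExact` (stmt-QuantumAdvantage-14043) — n = 12, a level-`≥ 6` side: (H3)/(H4) on the 9-flat `Z` when the
  non-8-divisible part of the residual off `Z` has at most `31` points (ANY position)

Certificate seat `b2b-cforr-cert` (gen 23).  HONEST FRAMING: finite-slice lemmas (standard axioms, no `decide`) about cubic Boolean pairs on 12 bits;
a small generalisation of gen 15's `tw15_H34_avoid` (there: the bad points sit in two cosets of `V₀`), needed for the mixed configuration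
"level-5(c) × level-6" at `Φ = 29/32`, where the partner's residual is `∓4` on (part of) a 16-point set `C`.  NOT summit progress.

* `sm_avoid_dirs`: greedy choice of three transversal directions whose seven translate families avoid `Z` and a bad set of `≤ 31` points.
* `sm_H34_small`: (H3) `4 ∣ Σ_{3-flat ⊂ Z} e` and (H4) `8 ∣ Σ_{4-flat ⊂ Z} e` for `e = u'' − (−1)^f`, `W_g = 64u''`, if `8 ∣ e` off `Z ∪ Bd`,
  `#Bd ≤ 31` (truncation of `u − 4s` as in `tw6_H34_tol`, localisation `ep_loc3`).

References: J. Ax (1964) / R. J. McEliece (1972); MacWilliams–Sloane (1977) Ch. 13 §3.  Axioms: the standard three.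
-/

set_option linter.dupNamespace false -- D-0017: single-problem summit ⇒ `QuantumAdvantage.QuantumAdvantage` by design

noncomputable section

namespace Summit.QuantumAdvantage.QuantumAdvantage.Theorems.CubicForrelation.NearExactIsExact

open Finset
open Literature.Computability.QuantumComplexity
open Literature.Computability.QuantumComplexity.BuzetChailloux (bxor zeroVec bxor_bxor_cancel_left bxor_zeroVec zeroVec_bxor bxor_comm
  bxor_self)
open Literature.Computability.QuantumComplexity.DerivativeWalsh (W)

/-! ### Avoiding directions -/

/-- **Avoiding transversal directions for a small bad set.**  `S = x_Z ⊕ V₀` a 9-flat (`#V₀ = 512`), `Bd` any set of at most `31` points,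
`G` a property holding off `S ∪ Bd`; for a parametrised `k`-flat inside `S` with `2^k ≤ 16` points there are `t₁, t₂, t₃` such that all seven
families of translates `q ⊕ t_T` (`∅ ≠ T ⊆ {1,2,3}`) of its points satisfy `G` (greedy choice: each step forbids at most
`4·(512 + 16·31) = 4032 < 4096` vectors). [this work] -/
theorem sm_avoid_dirs (V₀ S : Finset (Fin (6 + 6) → Bool)) (xZ : Fin (6 + 6) → Bool) (h0 : zeroVec ∈ V₀)
    (hadd : ∀ a ∈ V₀, ∀ b ∈ V₀, bxor a b ∈ V₀) (hcardV : #V₀ = 512) (hS : S = V₀.image (bxor xZ))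
    (G : (Fin (6 + 6) → Bool) → Prop) (Bd : Finset (Fin (6 + 6) → Bool))
    (hG : ∀ y, y ∉ S → y ∉ Bd → G y) (hc : #Bd ≤ 31)
    {k : ℕ} (hk : 2 ^ k ≤ 16) (x : Fin (6 + 6) → Bool) (hx : x ∈ S) (a : Fin k → Fin (6 + 6) → Bool) (ha : ∀ i, a i ∈ V₀) :
    ∃ t₁ t₂ t₃ : Fin (6 + 6) → Bool, ∀ ε : Fin k → Bool,
      G (bxor (fun j => x j ^^ decide (Odd #(univ.filter fun i => ε i && a i j))) t₁) ∧
      G (bxor (fun j => x j ^^ decide (Odd #(univ.filter fun i => ε i && a i j))) t₂) ∧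
      G (bxor (bxor (fun j => x j ^^ decide (Odd #(univ.filter fun i => ε i && a i j))) t₂) t₁) ∧
      G (bxor (fun j => x j ^^ decide (Odd #(univ.filter fun i => ε i && a i j))) t₃) ∧
      G (bxor (bxor (fun j => x j ^^ decide (Odd #(univ.filter fun i => ε i && a i j))) t₃) t₁) ∧
      G (bxor (bxor (fun j => x j ^^ decide (Odd #(univ.filter fun i => ε i && a i j))) t₃) t₂) ∧
      G (bxor (bxor (bxor (fun j => x j ^^ decide (Odd #(univ.filter fun i => ε i && a i j))) t₃) t₂) t₁) := by
  classical
  set pt : (Fin k → Bool) → (Fin (6 + 6) → Bool) := fun ε => (fun j => x j ^^ decide (Odd #(univ.filter fun i => ε i && a i j))) with hptdef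
  have hPV : ∀ x, x ∈ S → ∀ a ∈ V₀, bxor x a ∈ S := fun x hx a ha => fl1_coset_vadd hadd hS hx ha
  have hpt : ∀ ε, pt ε ∈ S := fun ε => ws_flatPt_mem V₀ h0 (· ∈ S) hPV k x hx a ha ε
  -- for `q ∈ S`: `q ⊕ w ∈ S ↔ w ∈ V₀`
  have hcritS : ∀ q ∈ S, ∀ w : Fin (6 + 6) → Bool, (bxor q w ∈ S ↔ w ∈ V₀) := by
    intro q hq w
    rw [hS] at hq ⊢
    obtain ⟨v, hv, rfl⟩ := mem_image.1 hq
    constructor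
    · intro h
      obtain ⟨v', hv', he⟩ := mem_image.1 h
      have ew : w = bxor v v' := by
        funext j
        have h1 := congrFun he j
        simp only [bxor] at h1 ⊢
        revert h1
        cases xZ j <;> cases v j <;> cases v' j <;> cases w j <;> decide
      rw [ew]; exact hadd v hv v' hv'
    · intro hw
      refine mem_image.2 ⟨bxor v w, hadd v hv w hw, ?_⟩
      funext j; simp only [bxor]; cases xZ j <;> cases v j <;> cases w j <;> rfl
  -- the forbidden set for one translate: `V₀ ∪ ⋃_ε (pt ε ⊕ Bd)`
  set Bad₀ := (univ : Finset (Fin k → Bool)).biUnion (fun ε => Bd.image (bxor (pt ε))) with hBad₀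
  have hBad₀card : #Bad₀ ≤ 496 := by
    calc #Bad₀ ≤ ∑ ε : Fin k → Bool, #(Bd.image (bxor (pt ε))) := card_biUnion_le
      _ ≤ ∑ ε : Fin k → Bool, #Bd := sum_le_sum fun ε _ => card_image_le
      _ = 2 ^ k * #Bd := by rw [sum_const, card_univ, Fintype.card_fun, Fintype.card_bool, Fintype.card_fin, smul_eq_mul]
      _ ≤ 16 * 31 := Nat.mul_le_mul hk hc
      _ = 496 := by norm_num
  set F₁ := V₀ ∪ Bad₀ with hF₁
  have hF₁card : #F₁ ≤ 1008 := (card_union_le _ _).trans (by rw [hcardV]; omega)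
  have hgood : ∀ w, w ∉ F₁ → ∀ ε, G (bxor (pt ε) w) := by
    intro w hw ε
    rw [hF₁, mem_union, not_or] at hw
    refine hG _ (fun h => hw.1 ((hcritS _ (hpt ε) w).1 h)) (fun h => hw.2 ?_)
    exact mem_biUnion.2 ⟨ε, mem_univ _, mem_image.2 ⟨bxor (pt ε) w, h, bxor_bxor_cancel_left _ _⟩⟩
  have hshift : ∀ w t : Fin (6 + 6) → Bool, w ∉ F₁.image (fun z => bxor z t) → bxor w t ∉ F₁ := by
    intro w t hw hmem
    exact hw (mem_image.2 ⟨bxor w t, hmem, by rw [iw_bxor_assoc, bxor_self, bxor_zeroVec]⟩)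
  have hcardim : ∀ t, #(F₁.image (fun z => bxor z t)) ≤ 1008 := fun t => card_image_le.trans hF₁card
  have huniv : #(univ : Finset (Fin (6 + 6) → Bool)) = 4096 := by
    rw [card_univ, Fintype.card_fun, Fintype.card_bool, Fintype.card_fin]; norm_num
  obtain ⟨t₁, -, ht₁⟩ : ∃ t, t ∈ univ ∧ t ∉ F₁ := exists_mem_notMem_of_card_lt_card (by rw [huniv]; omega)
  obtain ⟨t₂, -, ht₂⟩ : ∃ t, t ∈ univ ∧ t ∉ F₁ ∪ F₁.image (fun z => bxor z t₁) :=
    exists_mem_notMem_of_card_lt_card (by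
      have h1 := card_union_le F₁ (F₁.image (fun z => bxor z t₁))
      have h2 := hcardim t₁
      rw [huniv]; omega)
  rw [mem_union, not_or] at ht₂
  obtain ⟨t₃, -, ht₃⟩ : ∃ t, t ∈ univ ∧ t ∉ (F₁ ∪ F₁.image (fun z => bxor z t₁)) ∪
      (F₁.image (fun z => bxor z t₂) ∪ F₁.image (fun z => bxor z (bxor t₂ t₁))) :=
    exists_mem_notMem_of_card_lt_card (by
      have h1 := card_union_le (F₁ ∪ F₁.image (fun z => bxor z t₁))
        (F₁.image (fun z => bxor z t₂) ∪ F₁.image (fun z => bxor z (bxor t₂ t₁)))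
      have h2 := card_union_le F₁ (F₁.image (fun z => bxor z t₁))
      have h3 := card_union_le (F₁.image (fun z => bxor z t₂)) (F₁.image (fun z => bxor z (bxor t₂ t₁)))
      have h4 := hcardim t₁
      have h5 := hcardim t₂
      have h6 := hcardim (bxor t₂ t₁)
      rw [huniv]; omega)
  simp only [mem_union, not_or] at ht₃
  refine ⟨t₁, t₂, t₃, fun ε => ⟨hgood t₁ ht₁ ε, hgood t₂ ht₂.1 ε, ?_, hgood t₃ ht₃.1.1 ε, ?_, ?_, ?_⟩⟩
  · rw [iw_bxor_assoc]; exact hgood _ (hshift t₂ t₁ ht₂.2) ε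
  · rw [iw_bxor_assoc]; exact hgood _ (hshift t₃ t₁ ht₃.1.2) ε
  · rw [iw_bxor_assoc]; exact hgood _ (hshift t₃ t₂ ht₃.2.1) ε
  · rw [iw_bxor_assoc, iw_bxor_assoc]; exact hgood _ (hshift t₃ (bxor t₂ t₁) ht₃.2.2) ε

/-! ### (H3)/(H4) with a small bad set -/

/-- **(H3) and (H4) on the 9-flat with a small non-8-divisible set.**  Cubic `f, g`, `W_g = 64u''`, `Z = {u'' even} = x_Z ⊕ V₀` a 9-flat,
`e = u'' − (−1)^f`; if `8 ∣ e` off `Z ∪ Bd` for a set `Bd` of at most `31` points, then every parametrised 3-flat sum of `e` inside `Z` is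
`≡ 0 (mod 4)` and every 4-flat sum is `≡ 0 (mod 8)` (mechanism of `tw6_H34_tol` / `tw15_H34_avoid`, directions from `sm_avoid_dirs`).
[this work] -/
theorem sm_H34_small (f g : (Fin (6 + 6) → Bool) → Bool) (hf : IsDegLeFun 3 f) (hg : IsDegLeFun 3 g)
    (u'' : (Fin (6 + 6) → Bool) → ℤ) (hu'' : ∀ x, W (fun y => signOf (g y)) x = (2 : ℝ) ^ 6 * (u'' x : ℝ))
    (V₀ : Finset (Fin (6 + 6) → Bool)) (xZ : Fin (6 + 6) → Bool) (h0 : zeroVec ∈ V₀)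
    (hadd : ∀ a ∈ V₀, ∀ b ∈ V₀, bxor a b ∈ V₀) (hcardV : #V₀ = 512)
    (hS : (univ.filter fun x : Fin (6 + 6) → Bool => ¬ Odd (u'' x)) = V₀.image (bxor xZ))
    (Bd : Finset (Fin (6 + 6) → Bool))
    (hoff : ∀ y, y ∉ (univ.filter fun x : Fin (6 + 6) → Bool => ¬ Odd (u'' x)) → y ∉ Bd → (8 : ℤ) ∣ u'' y - sZ (f y))
    (hc : #Bd ≤ 31) :
    (∀ x ∈ (univ.filter fun x : Fin (6 + 6) → Bool => ¬ Odd (u'' x)), ∀ a b c : Fin (6 + 6) → Bool,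
      a ∈ V₀ → b ∈ V₀ → c ∈ V₀ →
      (4 : ℤ) ∣ ∑ ε : Fin 3 → Bool, (u'' (fun j => x j ^^ decide (Odd #(univ.filter fun i =>
        ε i && (![a, b, c] : Fin 3 → Fin (6 + 6) → Bool) i j))) - sZ (f (fun j => x j ^^ decide (Odd #(univ.filter fun i =>
        ε i && (![a, b, c] : Fin 3 → Fin (6 + 6) → Bool) i j)))))) ∧
    (∀ x ∈ (univ.filter fun x : Fin (6 + 6) → Bool => ¬ Odd (u'' x)), ∀ a₀ a₁ a₂ a₃ : Fin (6 + 6) → Bool,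
      a₀ ∈ V₀ → a₁ ∈ V₀ → a₂ ∈ V₀ → a₃ ∈ V₀ →
      (8 : ℤ) ∣ ∑ ε : Fin 4 → Bool, (u'' (fun j => x j ^^ decide (Odd #(univ.filter fun i =>
        ε i && (![a₀, a₁, a₂, a₃] : Fin 4 → Fin (6 + 6) → Bool) i j))) - sZ (f (fun j => x j ^^ decide (Odd #(univ.filter fun i =>
        ε i && (![a₀, a₁, a₂, a₃] : Fin 4 → Fin (6 + 6) → Bool) i j)))))) := by
  classical
  set Z := univ.filter (fun x : Fin (6 + 6) → Bool => ¬ Odd (u'' x)) with hZdef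
  set u : (Fin (6 + 6) → Bool) → ℤ := fun x => 4 * u'' x with hudef
  have hu : ∀ x, W (fun y => signOf (g y)) x = (2 : ℝ) ^ 4 * (u x : ℝ) := by
    intro x; rw [hu'' x]; simp only [u]; push_cast; ring
  set e : (Fin (6 + 6) → Bool) → ℤ := fun x => u'' x - sZ (f x) with hedef
  show (∀ x ∈ Z, ∀ a b c : Fin (6 + 6) → Bool, a ∈ V₀ → b ∈ V₀ → c ∈ V₀ →
      (4 : ℤ) ∣ ∑ ε : Fin 3 → Bool, e (fun j => x j ^^ decide (Odd #(univ.filter fun i =>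
        ε i && (![a, b, c] : Fin 3 → Fin (6 + 6) → Bool) i j)))) ∧
    (∀ x ∈ Z, ∀ a₀ a₁ a₂ a₃ : Fin (6 + 6) → Bool, a₀ ∈ V₀ → a₁ ∈ V₀ → a₂ ∈ V₀ → a₃ ∈ V₀ →
      (8 : ℤ) ∣ ∑ ε : Fin 4 → Bool, e (fun j => x j ^^ decide (Odd #(univ.filter fun i =>
        ε i && (![a₀, a₁, a₂, a₃] : Fin 4 → Fin (6 + 6) → Bool) i j))))
  change ∀ y, y ∉ Z → y ∉ Bd → (8 : ℤ) ∣ e y at hoff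
  have hFe : ∀ y, u y - 4 * sZ (f y) = 4 * e y := fun y => by simp only [u, e]; ring
  have hPV : ∀ x, x ∈ Z → ∀ a ∈ V₀, bxor x a ∈ Z := fun x hx a ha => fl1_coset_vadd hadd hS hx ha
  -- the truncation `F'`: `u − 4s` on `Z` and on the exceptional points, `0` elsewhere; `32 ∣ (u − 4s) − F'`
  set F' : (Fin (6 + 6) → Bool) → ℤ := fun y => if (y ∈ Z ∨ ¬ (8 : ℤ) ∣ e y) then u y - 4 * sZ (f y) else 0 with hF'
  have hdiffF : ∀ y, (32 : ℤ) ∣ (u y - 4 * sZ (f y)) - F' y := by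
    intro y
    by_cases hy : (y ∈ Z ∨ ¬ (8 : ℤ) ∣ e y)
    · simp only [F', if_pos hy, sub_self]; exact dvd_zero _
    · simp only [F', if_neg hy, sub_zero]
      rw [not_or, not_not] at hy
      obtain ⟨k, hk⟩ := hy.2
      exact ⟨k, by rw [hFe, hk]; ring⟩
  have hF'Z : ∀ y, y ∈ Z → F' y = 4 * e y := fun y hy => by simp only [F', if_pos (Or.inl hy)]; exact hFe y
  -- GOOD points: off `Z` with `8 ∣ e`; there `F' = 0`
  set G : (Fin (6 + 6) → Bool) → Prop := fun y => y ∉ Z ∧ (8 : ℤ) ∣ e y with hGdef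
  have hGF : ∀ y, G y → F' y = 0 := by
    intro y hy
    simp only [F']
    rw [if_neg]
    rw [not_or, not_not]
    exact ⟨hy.1, hy.2⟩
  have hG : ∀ y, y ∉ Z → y ∉ Bd → G y := fun y h1 h2 => ⟨h1, hoff y h1 h2⟩
  -- the localisation with avoiding directions
  have hloc : ∀ {k : ℕ}, 2 ^ k ≤ 16 → ∀ (x : Fin (6 + 6) → Bool), x ∈ Z → ∀ (a : Fin k → Fin (6 + 6) → Bool), (∀ i, a i ∈ V₀) →
      (∀ ε : Fin k → Bool, (fun j => x j ^^ decide (Odd #(univ.filter fun i => ε i && a i j))) ∈ Z) →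
      ∃ t₁ t₂ t₃ : Fin (6 + 6) → Bool,
      ∑ ε : Fin (k + 3) → Bool, F' (fun j => x j ^^ decide (Odd #(univ.filter fun i =>
          ε i && (Matrix.vecCons t₁ (Matrix.vecCons t₂ (Matrix.vecCons t₃ a)) : Fin (k + 3) → Fin (6 + 6) → Bool) i j))) =
      ∑ ε : Fin k → Bool, 4 * e (fun j => x j ^^ decide (Odd #(univ.filter fun i => ε i && a i j))) := by
    intro k hk x hx a ha hin
    obtain ⟨t₁, t₂, t₃, hgood⟩ := sm_avoid_dirs V₀ Z xZ h0 hadd hcardV hS G Bd hG hc hk x hx a ha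
    refine ⟨t₁, t₂, t₃, ?_⟩
    have key := ep_loc3 F' x t₁ t₂ t₃ a
      (fun ε => hGF _ (hgood ε).1) (fun ε => hGF _ (hgood ε).2.1) (fun ε => hGF _ (hgood ε).2.2.1)
      (fun ε => hGF _ (hgood ε).2.2.2.1) (fun ε => hGF _ (hgood ε).2.2.2.2.1) (fun ε => hGF _ (hgood ε).2.2.2.2.2.1)
      (fun ε => hGF _ (hgood ε).2.2.2.2.2.2)
    rw [key]
    exact sum_congr rfl fun ε _ => hF'Z _ (hin ε)
  have H3 : ∀ x ∈ Z, ∀ a b c : Fin (6 + 6) → Bool, a ∈ V₀ → b ∈ V₀ → c ∈ V₀ →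
      (4 : ℤ) ∣ ∑ ε : Fin 3 → Bool, e (fun j => x j ^^ decide (Odd #(univ.filter fun i =>
        ε i && (![a, b, c] : Fin 3 → Fin (6 + 6) → Bool) i j))) := by
    intro x hx a b c ha hb hc
    have hin : ∀ ε : Fin 3 → Bool, (fun j => x j ^^ decide (Odd #(univ.filter fun i =>
        ε i && (![a, b, c] : Fin 3 → Fin (6 + 6) → Bool) i j))) ∈ Z :=
      fun ε => fr_mem_flatPt3 V₀ h0 (· ∈ Z) hPV hx ![a, b, c] (fun i => by fin_cases i <;> assumption) ε
    obtain ⟨t₁, t₂, t₃, hl⟩ := hloc (by norm_num) x hx ![a, b, c] (fun i => by fin_cases i <;> assumption) hin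
    have h16 := fs_flat_sum_dvd (e := 4) g u hg hu x ![t₁, t₂, t₃, a, b, c] (by norm_num)
    obtain ⟨zf, hzf⟩ := sl_sum_sZ_flat f hf x ![t₁, t₂, t₃, a, b, c]
    have hzf' : ∑ ε : Fin 6 → Bool, 4 * sZ (f (fun j => x j ^^ decide (Odd #(univ.filter fun i =>
          ε i && (![t₁, t₂, t₃, a, b, c] : Fin 6 → Fin (6 + 6) → Bool) i j)))) = 16 * zf := by
      rw [← mul_sum, hzf]; norm_num; ring
    have h16n : (16 : ℤ) ∣ ∑ ε : Fin 6 → Bool, u (fun j => x j ^^ decide (Odd #(univ.filter fun i =>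
          ε i && (![t₁, t₂, t₃, a, b, c] : Fin 6 → Fin (6 + 6) → Bool) i j))) := by
      have e16 : (2 : ℤ) ^ 4 = 16 := by norm_num
      rw [e16] at h16; exact h16
    have h16' : (16 : ℤ) ∣ ∑ ε : Fin 6 → Bool, (u (fun j => x j ^^ decide (Odd #(univ.filter fun i =>
          ε i && (![t₁, t₂, t₃, a, b, c] : Fin 6 → Fin (6 + 6) → Bool) i j))) -
        4 * sZ (f (fun j => x j ^^ decide (Odd #(univ.filter fun i =>
          ε i && (![t₁, t₂, t₃, a, b, c] : Fin 6 → Fin (6 + 6) → Bool) i j))))) := by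
      rw [sum_sub_distrib, hzf']
      exact dvd_sub h16n (Dvd.intro _ rfl)
    have h16'' : (16 : ℤ) ∣ ∑ ε : Fin 6 → Bool, F' (fun j => x j ^^ decide (Odd #(univ.filter fun i =>
          ε i && (![t₁, t₂, t₃, a, b, c] : Fin 6 → Fin (6 + 6) → Bool) i j))) := by
      have hd : (32 : ℤ) ∣ ∑ ε : Fin 6 → Bool, ((u (fun j => x j ^^ decide (Odd #(univ.filter fun i =>
          ε i && (![t₁, t₂, t₃, a, b, c] : Fin 6 → Fin (6 + 6) → Bool) i j))) -
        4 * sZ (f (fun j => x j ^^ decide (Odd #(univ.filter fun i =>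
          ε i && (![t₁, t₂, t₃, a, b, c] : Fin 6 → Fin (6 + 6) → Bool) i j))))) -
        F' (fun j => x j ^^ decide (Odd #(univ.filter fun i =>
          ε i && (![t₁, t₂, t₃, a, b, c] : Fin 6 → Fin (6 + 6) → Bool) i j)))) := dvd_sum fun ε _ => hdiffF _
      rw [sum_sub_distrib] at hd
      have hd' : (16 : ℤ) ∣ _ := (show (16 : ℤ) ∣ 32 by norm_num).trans hd
      have := dvd_sub h16' hd'
      simpa using this
    rw [hl, ← mul_sum] at h16''
    obtain ⟨k16, hk16⟩ := h16''
    exact ⟨k16, by linarith⟩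
  have H4 : ∀ x ∈ Z, ∀ a₀ a₁ a₂ a₃ : Fin (6 + 6) → Bool, a₀ ∈ V₀ → a₁ ∈ V₀ → a₂ ∈ V₀ → a₃ ∈ V₀ →
      (8 : ℤ) ∣ ∑ ε : Fin 4 → Bool, e (fun j => x j ^^ decide (Odd #(univ.filter fun i =>
        ε i && (![a₀, a₁, a₂, a₃] : Fin 4 → Fin (6 + 6) → Bool) i j))) := by
    intro x hx a₀ a₁ a₂ a₃ ha₀ ha₁ ha₂ ha₃
    have hin : ∀ ε : Fin 4 → Bool, (fun j => x j ^^ decide (Odd #(univ.filter fun i =>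
        ε i && (![a₀, a₁, a₂, a₃] : Fin 4 → Fin (6 + 6) → Bool) i j))) ∈ Z :=
      fun ε => fr_mem_flatPt4 V₀ h0 (· ∈ Z) hPV hx ![a₀, a₁, a₂, a₃] (fun i => by fin_cases i <;> assumption) ε
    obtain ⟨t₁, t₂, t₃, hl⟩ := hloc (by norm_num) x hx ![a₀, a₁, a₂, a₃] (fun i => by fin_cases i <;> assumption) hin
    have h32 := fs_flat_sum_dvd (e := 5) g u hg hu x ![t₁, t₂, t₃, a₀, a₁, a₂, a₃] (by norm_num)
    obtain ⟨zf, hzf⟩ := sl_sum_sZ_flat f hf x ![t₁, t₂, t₃, a₀, a₁, a₂, a₃]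
    have hzf' : ∑ ε : Fin 7 → Bool, 4 * sZ (f (fun j => x j ^^ decide (Odd #(univ.filter fun i =>
          ε i && (![t₁, t₂, t₃, a₀, a₁, a₂, a₃] : Fin 7 → Fin (6 + 6) → Bool) i j)))) = 32 * zf := by
      rw [← mul_sum, hzf]; norm_num; ring
    have h32n : (32 : ℤ) ∣ ∑ ε : Fin 7 → Bool, u (fun j => x j ^^ decide (Odd #(univ.filter fun i =>
          ε i && (![t₁, t₂, t₃, a₀, a₁, a₂, a₃] : Fin 7 → Fin (6 + 6) → Bool) i j))) := by
      have e32 : (2 : ℤ) ^ 5 = 32 := by norm_num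
      rw [e32] at h32; exact h32
    have h32' : (32 : ℤ) ∣ ∑ ε : Fin 7 → Bool, (u (fun j => x j ^^ decide (Odd #(univ.filter fun i =>
          ε i && (![t₁, t₂, t₃, a₀, a₁, a₂, a₃] : Fin 7 → Fin (6 + 6) → Bool) i j))) -
        4 * sZ (f (fun j => x j ^^ decide (Odd #(univ.filter fun i =>
          ε i && (![t₁, t₂, t₃, a₀, a₁, a₂, a₃] : Fin 7 → Fin (6 + 6) → Bool) i j))))) := by
      rw [sum_sub_distrib, hzf']
      exact dvd_sub h32n (Dvd.intro _ rfl)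
    have h32'' : (32 : ℤ) ∣ ∑ ε : Fin 7 → Bool, F' (fun j => x j ^^ decide (Odd #(univ.filter fun i =>
          ε i && (![t₁, t₂, t₃, a₀, a₁, a₂, a₃] : Fin 7 → Fin (6 + 6) → Bool) i j))) := by
      have hd : (32 : ℤ) ∣ ∑ ε : Fin 7 → Bool, ((u (fun j => x j ^^ decide (Odd #(univ.filter fun i =>
          ε i && (![t₁, t₂, t₃, a₀, a₁, a₂, a₃] : Fin 7 → Fin (6 + 6) → Bool) i j))) -
        4 * sZ (f (fun j => x j ^^ decide (Odd #(univ.filter fun i =>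
          ε i && (![t₁, t₂, t₃, a₀, a₁, a₂, a₃] : Fin 7 → Fin (6 + 6) → Bool) i j))))) -
        F' (fun j => x j ^^ decide (Odd #(univ.filter fun i =>
          ε i && (![t₁, t₂, t₃, a₀, a₁, a₂, a₃] : Fin 7 → Fin (6 + 6) → Bool) i j)))) := dvd_sum fun ε _ => hdiffF _
      rw [sum_sub_distrib] at hd
      have := dvd_sub h32' hd
      simpa using this
    rw [hl, ← mul_sum] at h32''
    obtain ⟨k32, hk32⟩ := h32''
    exact ⟨k32, by linarith⟩
  exact ⟨H3, H4⟩

end Summit.QuantumAdvantage.QuantumAdvantage.Theorems.CubicForrelation.NearExactIsExact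

end
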